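import Summits.HodgeConjecture.HodgeConjecture.Theorems.R90S10LocalCarrierTransport   -- ★ PART 1 (this seat): `coe_localDet_eq_unitsMap`, `localDet_eq_unitsMap`, `unitsMap_mem_normOneUnits_iff`, the currency's `e₂ e₁ e_H`
import Literature.NumberTheory.Rogawski1990.LocalAPacket                                -- ★ `charDist`
import HarnessLib

/-!
# R90-TF · S10 (Rogawski 1990 §13.8) · THEOREMS — `R90S10XiLocalCharTransport`: the local character `ξ_v` of `H_v` and its distribution `χ_{ξ_v}(f^H)` transport along
# S3's local datum (PART 2 of the (U2) CARRIERS, sequel of ★ `Theorems/R90S10LocalCarrierTransport.lean`)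

Cell hodgecm-mathlib, slab R90-TF, section S10 = §13.8, crux item h413 = stmt-HodgeConjecture-24833 (route `route-HodgeConjecture-HCCMUnconditional`);
seat R90-C138-p05 (g0), card «(U2) carriers for `sock_S10_localTransportStBeta`» of DEAL-S10-WAVE1 (R90-C138-plan (g2)); consumer = the (U2) head
`Theorems/R90S10StSpectralHypAtTransport.lean` (R90-C138-p06), tokens (5) «`π₁ = charDist (ξ.xiLocalChar v)` transport» of its census.  Lane `--supports
stmt-HodgeConjecture-24833 --as helper`; THEOREMS ONLY (no definition, no instance, no notation, no `sorry`); ★-only imports; namespace `…R90.S10`.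

WHAT.  For one-dimensional automorphic `ξ = (η, ψ)` of `H(𝔸_{L⁺})` and `ξ′ = (η′, ψ′)` of `H′(𝔸_{L′⁺})` whose local components agree through S3's datum
`Φ : L ⊗ L⁺_v ≃+* L′ ⊗ L′⁺_{v′}` on the norm-one torus (the (U2) binders `hΦη hΦψ`), and the induced `e_H = e₂ × e₁ : H_v ≃ₜ* H′_{v′}` acting entrywise by `Φ`
(S3's bytes `he₂ he₁ heH`):
* `xiLocalChar_transport` ∕ `xiLocalChar_apply_equiv` — **`ξ′_{v′}(e_H h) = ξ_v(h)`** (`ξ_v(h₀, u) = η_v(det h₀) · ψ_v(det h₀ · u)`, ★ `xiLocalChar_apply_eq`, with both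
  determinants transported by PART 1's `coe_localDet_eq_unitsMap`);
* `xiLocalChar_comp_symm` — **`ξ_v ∘ e_H⁻¹ = ξ′_{v′}`** as homomorphisms (the `Ξ.comp eH.symm.toMulEquiv.toMonoidHom` slot of S3's G5);
* `charDist_map_equiv` ∕ `charDist_map_equiv_comp_symm` (generic change of variables for `χ_Ξ(f) = ∫ Ξ f dν` along `e : A ≃ₜ* B`, Mathlib `integral_map_equiv`) and
  **`charDist_xiLocalChar_transport`**: `χ_{ξ′_{v′}}(e_{H*} ν_H)(f^H ∘ e_H⁻¹) = χ_{ξ_v}(ν_H)(f^H)` at S3's measure convention `νH′ = νH.map eH`.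
No statement of any socket is restated here; nothing here closes a socket by itself.

HONEST LABEL: transport-of-structure bookkeeping, no print input [Rogawski1990 §14.2 p. 232 «`G′_v` is isomorphic to `G_v`»]; HC_CM is proved only modulo the 7
printed citations (2 remaining named inputs: hLiu418 = stmt-HodgeConjecture-24832, h413 = stmt-HodgeConjecture-24833) until rung 0 closes; count-neutral helper.

## References
* [Rogawski1990] J. D. Rogawski, *Automorphic Representations of Unitary Groups in Three Variables*, Ann. of Math. Stud. 123 (1990), §12.2 p. 174 (`χ_ξ`), §13.1 Prop. 13.1.4
  p. 199 (`ξ(f^H)`), §13.3 p. 202 (`ξ(h) = η(det₀ h) ψ(det h)`), §14.2 p. 232.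
* [PlatonovRapinchuk1994] V. Platonov, A. Rapinchuk, *Algebraic Groups and Number Theory* (1994), §5.1 (`G(K ⊗ K_v)`).
-/

set_option autoImplicit false
-- the mandated namespace repeats the single-problem summit's segment (`HodgeConjecture.HodgeConjecture`)
set_option linter.dupNamespace false

noncomputable section

open MeasureTheory Topology IsDedekindDomain NumberField Matrix
open Literature.NumberTheory Literature.NumberTheory.Automorphic Literature.NumberTheory.Automorphic.UnitaryGroup
open Literature.NumberTheory.Rogawski1990 Literature.NumberTheory.GaloisRepresentations
open scoped MatrixGroups NNReal

namespace Summit.HodgeConjecture.HodgeConjecture.R90.S10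

/-! ## §1 `ξ′_{v′} ∘ e_H = ξ_v` -/

section CM

variable (L : Type) [Field L] [NumberField L] [IsCMField L] (v : HeightOneSpectrum (𝓞 ↥(maximalRealSubfield L)))
  (L' : Type) [Field L'] [NumberField L'] [IsCMField L'] (v' : HeightOneSpectrum (𝓞 ↥(maximalRealSubfield L')))
  (Φ : UnitaryGroup.LocalRing L v ≃+* UnitaryGroup.LocalRing L' v')

/-- **`ξ′_{v′}(h′) = ξ_v(h)` for `h′ = Φ·h` componentwise** — the local character `ξ_v(h₀, u) = η_v(det h₀) · ψ_v(det h₀ · u)` (★ `xiLocalChar_apply_eq`) with both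
determinants transported (`coe_localDet_eq_unitsMap`) and the binders `hΦη hΦψ`. [cite: Rogawski1990, §13.3 p. 202; §12.2 p. 174; §14.2 p. 232] -/
theorem xiLocalChar_transport
    (hΦσ : ∀ x, Φ ((conjLocal L (IsCMField.complexConj L) v) x) = (conjLocal L' (IsCMField.complexConj L') v') (Φ x))
    (ξ : OneDimAutRepH L) (ξ' : OneDimAutRepH L')
    (hΦη : ∀ (t : ↥(normOneUnits (conjLocal L (IsCMField.complexConj L) v)))
      (ht : Units.map (Φ : UnitaryGroup.LocalRing L v →+* UnitaryGroup.LocalRing L' v').toMonoidHom t.1 ∈ normOneUnits (conjLocal L' (IsCMField.complexConj L') v')),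
      torusLocalComponent L' (IsCMField.complexConj L') v' ξ'.η ⟨Units.map (Φ : UnitaryGroup.LocalRing L v →+* UnitaryGroup.LocalRing L' v').toMonoidHom t.1, ht⟩ =
        torusLocalComponent L (IsCMField.complexConj L) v ξ.η t)
    (hΦψ : ∀ (t : ↥(normOneUnits (conjLocal L (IsCMField.complexConj L) v)))
      (ht : Units.map (Φ : UnitaryGroup.LocalRing L v →+* UnitaryGroup.LocalRing L' v').toMonoidHom t.1 ∈ normOneUnits (conjLocal L' (IsCMField.complexConj L') v')),
      torusLocalComponent L' (IsCMField.complexConj L') v' ξ'.ψ ⟨Units.map (Φ : UnitaryGroup.LocalRing L v →+* UnitaryGroup.LocalRing L' v').toMonoidHom t.1, ht⟩ =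
        torusLocalComponent L (IsCMField.complexConj L) v ξ.ψ t)
    (h : (UnitaryGroup.cmDatum L 2 (Matrix.of fun i j : Fin 2 => if i.val + j.val + 1 = 2 then (1 : L) else 0)).Local v ×
      (UnitaryGroup.cmDatum L 1 (Matrix.of fun i j : Fin 1 => if i.val + j.val + 1 = 1 then (1 : L) else 0)).Local v)
    (h' : (UnitaryGroup.cmDatum L' 2 (Matrix.of fun i j : Fin 2 => if i.val + j.val + 1 = 2 then (1 : L') else 0)).Local v' ×
      (UnitaryGroup.cmDatum L' 1 (Matrix.of fun i j : Fin 1 => if i.val + j.val + 1 = 1 then (1 : L') else 0)).Local v')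
    (hh₁ : (h'.1.val : GL (Fin 2) (UnitaryGroup.LocalRing L' v')) =
      Matrix.GeneralLinearGroup.map (Φ : UnitaryGroup.LocalRing L v →+* UnitaryGroup.LocalRing L' v') (h.1.val : GL (Fin 2) (UnitaryGroup.LocalRing L v)))
    (hh₂ : (h'.2.val : GL (Fin 1) (UnitaryGroup.LocalRing L' v')) =
      Matrix.GeneralLinearGroup.map (Φ : UnitaryGroup.LocalRing L v →+* UnitaryGroup.LocalRing L' v') (h.2.val : GL (Fin 1) (UnitaryGroup.LocalRing L v))) :
    ξ'.xiLocalChar v' h' = ξ.xiLocalChar v h := by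
  have hprod : localDet (IsCMField.complexConj L') v' (isUnit_antidiagOne_det L' 2) h'.1 *
        localDet (IsCMField.complexConj L') v' (isUnit_antidiagOne_det L' 1) h'.2 =
      ⟨Units.map (Φ : UnitaryGroup.LocalRing L v →+* UnitaryGroup.LocalRing L' v').toMonoidHom
          ((localDet (IsCMField.complexConj L) v (isUnit_antidiagOne_det L 2) h.1 *
              localDet (IsCMField.complexConj L) v (isUnit_antidiagOne_det L 1) h.2 :
              ↥(normOneUnits (conjLocal L (IsCMField.complexConj L) v))) : (UnitaryGroup.LocalRing L v)ˣ),
        (unitsMap_mem_normOneUnits_iff Φ hΦσ _).2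
          (localDet (IsCMField.complexConj L) v (isUnit_antidiagOne_det L 2) h.1 *
            localDet (IsCMField.complexConj L) v (isUnit_antidiagOne_det L 1) h.2).2⟩ := by
    refine Subtype.ext ?_
    show ((localDet (IsCMField.complexConj L') v' (isUnit_antidiagOne_det L' 2) h'.1 *
          localDet (IsCMField.complexConj L') v' (isUnit_antidiagOne_det L' 1) h'.2 :
          ↥(normOneUnits (conjLocal L' (IsCMField.complexConj L') v'))) : (UnitaryGroup.LocalRing L' v')ˣ) =
      Units.map (Φ : UnitaryGroup.LocalRing L v →+* UnitaryGroup.LocalRing L' v').toMonoidHom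
        ((localDet (IsCMField.complexConj L) v (isUnit_antidiagOne_det L 2) h.1 *
            localDet (IsCMField.complexConj L) v (isUnit_antidiagOne_det L 1) h.2 :
            ↥(normOneUnits (conjLocal L (IsCMField.complexConj L) v))) : (UnitaryGroup.LocalRing L v)ˣ)
    rw [Subgroup.coe_mul, Subgroup.coe_mul, map_mul, coe_localDet_eq_unitsMap L v L' v' Φ h.1 h'.1 hh₁,
      coe_localDet_eq_unitsMap L v L' v' Φ h.2 h'.2 hh₂]
  have h1 := localDet_eq_unitsMap L v L' v' Φ hΦσ h.1 h'.1 hh₁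
  -- the two factors separately (explicit `trans`, no metavariable rewriting)
  have e1 : torusLocalComponent L' (IsCMField.complexConj L') v' ξ'.η (localDet (IsCMField.complexConj L') v' (isUnit_antidiagOne_det L' 2) h'.1) =
      torusLocalComponent L (IsCMField.complexConj L) v ξ.η (localDet (IsCMField.complexConj L) v (isUnit_antidiagOne_det L 2) h.1) :=
    (congrArg (torusLocalComponent L' (IsCMField.complexConj L') v' ξ'.η) h1).trans (hΦη _ _)
  have e2 : torusLocalComponent L' (IsCMField.complexConj L') v' ξ'.ψ
        (localDet (IsCMField.complexConj L') v' (isUnit_antidiagOne_det L' 2) h'.1 *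
          localDet (IsCMField.complexConj L') v' (isUnit_antidiagOne_det L' 1) h'.2) =
      torusLocalComponent L (IsCMField.complexConj L) v ξ.ψ
        (localDet (IsCMField.complexConj L) v (isUnit_antidiagOne_det L 2) h.1 *
          localDet (IsCMField.complexConj L) v (isUnit_antidiagOne_det L 1) h.2) :=
    (congrArg (torusLocalComponent L' (IsCMField.complexConj L') v' ξ'.ψ) hprod).trans (hΦψ _ _)
  rw [OneDimAutRepH.xiLocalChar_apply_eq, OneDimAutRepH.xiLocalChar_apply_eq, e1, e2]

/-- **`ξ′_{v′} ∘ e_H = ξ_v`** pointwise, at S3's binders `(e₂, he₂), (e₁, he₁), (e_H, heH)`. [cite: Rogawski1990, §13.3 p. 202; §14.2 p. 232] -/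
theorem xiLocalChar_apply_equiv
    (hΦσ : ∀ x, Φ ((conjLocal L (IsCMField.complexConj L) v) x) = (conjLocal L' (IsCMField.complexConj L') v') (Φ x))
    (ξ : OneDimAutRepH L) (ξ' : OneDimAutRepH L')
    (hΦη : ∀ (t : ↥(normOneUnits (conjLocal L (IsCMField.complexConj L) v)))
      (ht : Units.map (Φ : UnitaryGroup.LocalRing L v →+* UnitaryGroup.LocalRing L' v').toMonoidHom t.1 ∈ normOneUnits (conjLocal L' (IsCMField.complexConj L') v')),
      torusLocalComponent L' (IsCMField.complexConj L') v' ξ'.η ⟨Units.map (Φ : UnitaryGroup.LocalRing L v →+* UnitaryGroup.LocalRing L' v').toMonoidHom t.1, ht⟩ =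
        torusLocalComponent L (IsCMField.complexConj L) v ξ.η t)
    (hΦψ : ∀ (t : ↥(normOneUnits (conjLocal L (IsCMField.complexConj L) v)))
      (ht : Units.map (Φ : UnitaryGroup.LocalRing L v →+* UnitaryGroup.LocalRing L' v').toMonoidHom t.1 ∈ normOneUnits (conjLocal L' (IsCMField.complexConj L') v')),
      torusLocalComponent L' (IsCMField.complexConj L') v' ξ'.ψ ⟨Units.map (Φ : UnitaryGroup.LocalRing L v →+* UnitaryGroup.LocalRing L' v').toMonoidHom t.1, ht⟩ =
        torusLocalComponent L (IsCMField.complexConj L) v ξ.ψ t)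
    (e₂ : (UnitaryGroup.cmDatum L 2 (Matrix.of fun i j : Fin 2 => if i.val + j.val + 1 = 2 then (1 : L) else 0)).Local v ≃ₜ*
      (UnitaryGroup.cmDatum L' 2 (Matrix.of fun i j : Fin 2 => if i.val + j.val + 1 = 2 then (1 : L') else 0)).Local v')
    (he₂ : ∀ g, ((e₂ g).val : GL (Fin 2) (UnitaryGroup.LocalRing L' v')) = Matrix.GeneralLinearGroup.map (Φ : UnitaryGroup.LocalRing L v →+* UnitaryGroup.LocalRing L' v') (g.val : GL (Fin 2) (UnitaryGroup.LocalRing L v)))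
    (e₁ : (UnitaryGroup.cmDatum L 1 (Matrix.of fun i j : Fin 1 => if i.val + j.val + 1 = 1 then (1 : L) else 0)).Local v ≃ₜ*
      (UnitaryGroup.cmDatum L' 1 (Matrix.of fun i j : Fin 1 => if i.val + j.val + 1 = 1 then (1 : L') else 0)).Local v')
    (he₁ : ∀ g, ((e₁ g).val : GL (Fin 1) (UnitaryGroup.LocalRing L' v')) = Matrix.GeneralLinearGroup.map (Φ : UnitaryGroup.LocalRing L v →+* UnitaryGroup.LocalRing L' v') (g.val : GL (Fin 1) (UnitaryGroup.LocalRing L v)))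
    (eH : ((UnitaryGroup.cmDatum L 2 (Matrix.of fun i j : Fin 2 => if i.val + j.val + 1 = 2 then (1 : L) else 0)).Local v ×
      (UnitaryGroup.cmDatum L 1 (Matrix.of fun i j : Fin 1 => if i.val + j.val + 1 = 1 then (1 : L) else 0)).Local v) ≃ₜ*
      ((UnitaryGroup.cmDatum L' 2 (Matrix.of fun i j : Fin 2 => if i.val + j.val + 1 = 2 then (1 : L') else 0)).Local v' ×
      (UnitaryGroup.cmDatum L' 1 (Matrix.of fun i j : Fin 1 => if i.val + j.val + 1 = 1 then (1 : L') else 0)).Local v'))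
    (heH : ∀ h, eH h = (e₂ h.1, e₁ h.2))
    (h : (UnitaryGroup.cmDatum L 2 (Matrix.of fun i j : Fin 2 => if i.val + j.val + 1 = 2 then (1 : L) else 0)).Local v ×
      (UnitaryGroup.cmDatum L 1 (Matrix.of fun i j : Fin 1 => if i.val + j.val + 1 = 1 then (1 : L) else 0)).Local v) :
    ξ'.xiLocalChar v' (eH h) = ξ.xiLocalChar v h := by
  rw [heH]
  exact xiLocalChar_transport L v L' v' Φ hΦσ ξ ξ' hΦη hΦψ h (e₂ h.1, e₁ h.2) (he₂ h.1) (he₁ h.2)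

/-- **`ξ_v ∘ e_H⁻¹ = ξ′_{v′}`** as homomorphisms — the `Ξ.comp eH.symm.toMulEquiv.toMonoidHom` slot of S3's G5 (`stub_R90_S3_transport_charIdentitySigned`) IS `ξ′.xiLocalChar v′` when
`Ξ = ξ.xiLocalChar v`. [cite: Rogawski1990, §13.3 p. 202; §13.1 Prop. 13.1.4 p. 199; §14.2 p. 232] -/
theorem xiLocalChar_comp_symm
    (hΦσ : ∀ x, Φ ((conjLocal L (IsCMField.complexConj L) v) x) = (conjLocal L' (IsCMField.complexConj L') v') (Φ x))
    (ξ : OneDimAutRepH L) (ξ' : OneDimAutRepH L')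
    (hΦη : ∀ (t : ↥(normOneUnits (conjLocal L (IsCMField.complexConj L) v)))
      (ht : Units.map (Φ : UnitaryGroup.LocalRing L v →+* UnitaryGroup.LocalRing L' v').toMonoidHom t.1 ∈ normOneUnits (conjLocal L' (IsCMField.complexConj L') v')),
      torusLocalComponent L' (IsCMField.complexConj L') v' ξ'.η ⟨Units.map (Φ : UnitaryGroup.LocalRing L v →+* UnitaryGroup.LocalRing L' v').toMonoidHom t.1, ht⟩ =
        torusLocalComponent L (IsCMField.complexConj L) v ξ.η t)
    (hΦψ : ∀ (t : ↥(normOneUnits (conjLocal L (IsCMField.complexConj L) v)))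
      (ht : Units.map (Φ : UnitaryGroup.LocalRing L v →+* UnitaryGroup.LocalRing L' v').toMonoidHom t.1 ∈ normOneUnits (conjLocal L' (IsCMField.complexConj L') v')),
      torusLocalComponent L' (IsCMField.complexConj L') v' ξ'.ψ ⟨Units.map (Φ : UnitaryGroup.LocalRing L v →+* UnitaryGroup.LocalRing L' v').toMonoidHom t.1, ht⟩ =
        torusLocalComponent L (IsCMField.complexConj L) v ξ.ψ t)
    (e₂ : (UnitaryGroup.cmDatum L 2 (Matrix.of fun i j : Fin 2 => if i.val + j.val + 1 = 2 then (1 : L) else 0)).Local v ≃ₜ*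
      (UnitaryGroup.cmDatum L' 2 (Matrix.of fun i j : Fin 2 => if i.val + j.val + 1 = 2 then (1 : L') else 0)).Local v')
    (he₂ : ∀ g, ((e₂ g).val : GL (Fin 2) (UnitaryGroup.LocalRing L' v')) = Matrix.GeneralLinearGroup.map (Φ : UnitaryGroup.LocalRing L v →+* UnitaryGroup.LocalRing L' v') (g.val : GL (Fin 2) (UnitaryGroup.LocalRing L v)))
    (e₁ : (UnitaryGroup.cmDatum L 1 (Matrix.of fun i j : Fin 1 => if i.val + j.val + 1 = 1 then (1 : L) else 0)).Local v ≃ₜ*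
      (UnitaryGroup.cmDatum L' 1 (Matrix.of fun i j : Fin 1 => if i.val + j.val + 1 = 1 then (1 : L') else 0)).Local v')
    (he₁ : ∀ g, ((e₁ g).val : GL (Fin 1) (UnitaryGroup.LocalRing L' v')) = Matrix.GeneralLinearGroup.map (Φ : UnitaryGroup.LocalRing L v →+* UnitaryGroup.LocalRing L' v') (g.val : GL (Fin 1) (UnitaryGroup.LocalRing L v)))
    (eH : ((UnitaryGroup.cmDatum L 2 (Matrix.of fun i j : Fin 2 => if i.val + j.val + 1 = 2 then (1 : L) else 0)).Local v ×
      (UnitaryGroup.cmDatum L 1 (Matrix.of fun i j : Fin 1 => if i.val + j.val + 1 = 1 then (1 : L) else 0)).Local v) ≃ₜ*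
      ((UnitaryGroup.cmDatum L' 2 (Matrix.of fun i j : Fin 2 => if i.val + j.val + 1 = 2 then (1 : L') else 0)).Local v' ×
      (UnitaryGroup.cmDatum L' 1 (Matrix.of fun i j : Fin 1 => if i.val + j.val + 1 = 1 then (1 : L') else 0)).Local v'))
    (heH : ∀ h, eH h = (e₂ h.1, e₁ h.2)) :
    (ξ.xiLocalChar v).comp eH.symm.toMulEquiv.toMonoidHom = ξ'.xiLocalChar v' := by
  refine MonoidHom.ext fun h' => ?_
  have key := xiLocalChar_apply_equiv L v L' v' Φ hΦσ ξ ξ' hΦη hΦψ e₂ he₂ e₁ he₁ eH heH (eH.symm h')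
  rw [ContinuousMulEquiv.apply_symm_apply] at key
  exact key.symm

end CM

/-! ## §2 The distribution `χ_Ξ(f) = ∫ Ξ f dν` under a change of variables (generic), and the `charDist (ξ.xiLocalChar v)` slot -/

section CharDist

variable {A B : Type*} [Group A] [Group B] [TopologicalSpace A] [TopologicalSpace B]
  [MeasurableSpace A] [BorelSpace A] [MeasurableSpace B] [BorelSpace B]

/-- **Change of variables for `χ_Ξ`**: along `e : A ≃ₜ* B` with `Ξ′ ∘ e = Ξ`, `χ_{Ξ′}(e_* ν)(φ) = χ_Ξ(ν)(φ ∘ e)` (★ `charDist_def`, Mathlib `integral_map_equiv`).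
[cite: Rogawski1990, §13.1 Prop. 13.1.4 p. 199] -/
theorem charDist_map_equiv (e : A ≃ₜ* B) (Ξ : A →* ℂˣ) (Ξ' : B →* ℂˣ) (hΞ : ∀ a, Ξ' (e a) = Ξ a) (ν : Measure A) (φ : B → ℂ) :
    charDist Ξ' (ν.map e) φ = charDist Ξ ν (φ ∘ e) := by
  rw [charDist_def, charDist_def]
  have hm : ν.map e = ν.map e.toHomeomorph.toMeasurableEquiv := rfl
  rw [hm, MeasureTheory.integral_map_equiv]
  refine integral_congr_ae (Filter.Eventually.of_forall fun a => ?_)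
  change ((Ξ' (e a) : ℂˣ) : ℂ) * φ (e a) = ((Ξ a : ℂˣ) : ℂ) * (φ ∘ e) a
  rw [hΞ, Function.comp_apply]

/-- The same with the test function written `f ∘ e⁻¹` (S3's convention `fH ∘ eH.symm`): `χ_{Ξ′}(e_* ν)(f ∘ e⁻¹) = χ_Ξ(ν)(f)`. [cite: Rogawski1990, §13.1 Prop. 13.1.4 p. 199] -/
theorem charDist_map_equiv_comp_symm (e : A ≃ₜ* B) (Ξ : A →* ℂˣ) (Ξ' : B →* ℂˣ) (hΞ : ∀ a, Ξ' (e a) = Ξ a) (ν : Measure A) (f : A → ℂ) :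
    charDist Ξ' (ν.map e) (f ∘ e.symm) = charDist Ξ ν f := by
  rw [charDist_map_equiv e Ξ Ξ' hΞ]
  congr 1
  funext a
  simp only [Function.comp_apply, ContinuousMulEquiv.symm_apply_apply]

end CharDist

section CMCharDist

variable (L : Type) [Field L] [NumberField L] [IsCMField L] (v : HeightOneSpectrum (𝓞 ↥(maximalRealSubfield L)))
  (L' : Type) [Field L'] [NumberField L'] [IsCMField L'] (v' : HeightOneSpectrum (𝓞 ↥(maximalRealSubfield L')))
  (Φ : UnitaryGroup.LocalRing L v ≃+* UnitaryGroup.LocalRing L' v')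

/-- **THE `charDist (ξ.xiLocalChar v)` SLOT OF (S-β) TRANSPORTS**: `χ_{ξ′_{v′}}(e_{H*} ν_H)(f^H ∘ e_H⁻¹) = χ_{ξ_v}(ν_H)(f^H)` at S3's binders and measure convention
`νH′ = νH.map eH` (`xiLocalChar_apply_equiv` + `charDist_map_equiv_comp_symm`). [cite: Rogawski1990, §13.1 Prop. 13.1.4 p. 199; §13.3 p. 202; §14.2 p. 232] -/
theorem charDist_xiLocalChar_transport
    (hΦσ : ∀ x, Φ ((conjLocal L (IsCMField.complexConj L) v) x) = (conjLocal L' (IsCMField.complexConj L') v') (Φ x))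
    (ξ : OneDimAutRepH L) (ξ' : OneDimAutRepH L')
    (hΦη : ∀ (t : ↥(normOneUnits (conjLocal L (IsCMField.complexConj L) v)))
      (ht : Units.map (Φ : UnitaryGroup.LocalRing L v →+* UnitaryGroup.LocalRing L' v').toMonoidHom t.1 ∈ normOneUnits (conjLocal L' (IsCMField.complexConj L') v')),
      torusLocalComponent L' (IsCMField.complexConj L') v' ξ'.η ⟨Units.map (Φ : UnitaryGroup.LocalRing L v →+* UnitaryGroup.LocalRing L' v').toMonoidHom t.1, ht⟩ =
        torusLocalComponent L (IsCMField.complexConj L) v ξ.η t)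
    (hΦψ : ∀ (t : ↥(normOneUnits (conjLocal L (IsCMField.complexConj L) v)))
      (ht : Units.map (Φ : UnitaryGroup.LocalRing L v →+* UnitaryGroup.LocalRing L' v').toMonoidHom t.1 ∈ normOneUnits (conjLocal L' (IsCMField.complexConj L') v')),
      torusLocalComponent L' (IsCMField.complexConj L') v' ξ'.ψ ⟨Units.map (Φ : UnitaryGroup.LocalRing L v →+* UnitaryGroup.LocalRing L' v').toMonoidHom t.1, ht⟩ =
        torusLocalComponent L (IsCMField.complexConj L) v ξ.ψ t)
    (e₂ : (UnitaryGroup.cmDatum L 2 (Matrix.of fun i j : Fin 2 => if i.val + j.val + 1 = 2 then (1 : L) else 0)).Local v ≃ₜ*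
      (UnitaryGroup.cmDatum L' 2 (Matrix.of fun i j : Fin 2 => if i.val + j.val + 1 = 2 then (1 : L') else 0)).Local v')
    (he₂ : ∀ g, ((e₂ g).val : GL (Fin 2) (UnitaryGroup.LocalRing L' v')) = Matrix.GeneralLinearGroup.map (Φ : UnitaryGroup.LocalRing L v →+* UnitaryGroup.LocalRing L' v') (g.val : GL (Fin 2) (UnitaryGroup.LocalRing L v)))
    (e₁ : (UnitaryGroup.cmDatum L 1 (Matrix.of fun i j : Fin 1 => if i.val + j.val + 1 = 1 then (1 : L) else 0)).Local v ≃ₜ*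
      (UnitaryGroup.cmDatum L' 1 (Matrix.of fun i j : Fin 1 => if i.val + j.val + 1 = 1 then (1 : L') else 0)).Local v')
    (he₁ : ∀ g, ((e₁ g).val : GL (Fin 1) (UnitaryGroup.LocalRing L' v')) = Matrix.GeneralLinearGroup.map (Φ : UnitaryGroup.LocalRing L v →+* UnitaryGroup.LocalRing L' v') (g.val : GL (Fin 1) (UnitaryGroup.LocalRing L v)))
    (eH : ((UnitaryGroup.cmDatum L 2 (Matrix.of fun i j : Fin 2 => if i.val + j.val + 1 = 2 then (1 : L) else 0)).Local v ×
      (UnitaryGroup.cmDatum L 1 (Matrix.of fun i j : Fin 1 => if i.val + j.val + 1 = 1 then (1 : L) else 0)).Local v) ≃ₜ*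
      ((UnitaryGroup.cmDatum L' 2 (Matrix.of fun i j : Fin 2 => if i.val + j.val + 1 = 2 then (1 : L') else 0)).Local v' ×
      (UnitaryGroup.cmDatum L' 1 (Matrix.of fun i j : Fin 1 => if i.val + j.val + 1 = 1 then (1 : L') else 0)).Local v'))
    (heH : ∀ h, eH h = (e₂ h.1, e₁ h.2))
    [MeasurableSpace ((UnitaryGroup.cmDatum L 2 (Matrix.of fun i j : Fin 2 => if i.val + j.val + 1 = 2 then (1 : L) else 0)).Local v ×
      (UnitaryGroup.cmDatum L 1 (Matrix.of fun i j : Fin 1 => if i.val + j.val + 1 = 1 then (1 : L) else 0)).Local v)]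
    [BorelSpace ((UnitaryGroup.cmDatum L 2 (Matrix.of fun i j : Fin 2 => if i.val + j.val + 1 = 2 then (1 : L) else 0)).Local v ×
      (UnitaryGroup.cmDatum L 1 (Matrix.of fun i j : Fin 1 => if i.val + j.val + 1 = 1 then (1 : L) else 0)).Local v)]
    [MeasurableSpace ((UnitaryGroup.cmDatum L' 2 (Matrix.of fun i j : Fin 2 => if i.val + j.val + 1 = 2 then (1 : L') else 0)).Local v' ×
      (UnitaryGroup.cmDatum L' 1 (Matrix.of fun i j : Fin 1 => if i.val + j.val + 1 = 1 then (1 : L') else 0)).Local v')]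
    [BorelSpace ((UnitaryGroup.cmDatum L' 2 (Matrix.of fun i j : Fin 2 => if i.val + j.val + 1 = 2 then (1 : L') else 0)).Local v' ×
      (UnitaryGroup.cmDatum L' 1 (Matrix.of fun i j : Fin 1 => if i.val + j.val + 1 = 1 then (1 : L') else 0)).Local v')]
    (νH : Measure ((UnitaryGroup.cmDatum L 2 (Matrix.of fun i j : Fin 2 => if i.val + j.val + 1 = 2 then (1 : L) else 0)).Local v ×
      (UnitaryGroup.cmDatum L 1 (Matrix.of fun i j : Fin 1 => if i.val + j.val + 1 = 1 then (1 : L) else 0)).Local v))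
    (fH : ((UnitaryGroup.cmDatum L 2 (Matrix.of fun i j : Fin 2 => if i.val + j.val + 1 = 2 then (1 : L) else 0)).Local v ×
      (UnitaryGroup.cmDatum L 1 (Matrix.of fun i j : Fin 1 => if i.val + j.val + 1 = 1 then (1 : L) else 0)).Local v) → ℂ) :
    charDist (ξ'.xiLocalChar v') (νH.map eH) (fH ∘ eH.symm) = charDist (ξ.xiLocalChar v) νH fH :=
  charDist_map_equiv_comp_symm eH (ξ.xiLocalChar v) (ξ'.xiLocalChar v') (xiLocalChar_apply_equiv L v L' v' Φ hΦσ ξ ξ' hΦη hΦψ e₂ he₂ e₁ he₁ eH heH) νH fH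

end CMCharDist

end Summit.HodgeConjecture.HodgeConjecture.R90.S10

end
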